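import Summits.CriticalPhenomena.PercolationContinuityZ3.Theorems.PercNearOneGluingNoHeavyLowerTailApexTwoSumGlue
import Summits.CriticalPhenomena.PercolationContinuityZ3.Theorems.PercNearOneGluingNoHeavyLowerTailThreeSumCells
import HarnessLib

/-!
# `NoHeavyLowerTail` (stmt-CriticalPhenomena-4575) — 1-sums, the APEX BLOCK: join and separation rules for a block
# containing the apex hanging at a cut vertex `u`

Support file (prover prim-gen-kcluster gen 72; `--supports stmt-CriticalPhenomena-4575`).  Pure graph combinatorics: no measures,
no definitions, no named facts, no sorries.

SETTING (gen 57 §3.2 "cut vertices", the case where the apex's block contains no terminal).  Supports `DX DY : Finset (Sym2 V)` meeting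
only in the cut vertex `u` (`hsepD`); the apex `a ≠ u` is private to `DX`; the terminals `b, c ≠ u` are private to `DY`.  Blocks
`ζ_X = ω ∩ DX`, `ζ_Y = ω ∖ DX`.  Wiring the single vertex `u` does nothing (`clusterCount_pair_self`), so the counts of the blocks add
without correction (`ApexTwoSum.kT_add` with `(a, h) := (u, u)`).
* `OneSumApex.glued_b_iff / glued_c_iff` — `b ∈ C(a)` iff `u ∈ C_X(a)` and `b ∈ C_Y(u)` (`APL.series_ou_iff`); same for `c`;
  `glued_cb_iff` — `c ∈ C(b)` iff `c ∈ C_Y(b)`.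
* `OneSumApex.sep_iff_of_mem` — if `u ∈ C_X(a)` and `b, c ∉ C(a)`: `C(a)` cuts `b|c` in `DX ∪ DY` iff `C_Y(u)` cuts `b|c` in `DY`;
  `OneSumApex.not_sep_of_not_mem` — if `u ∉ C_X(a)` and `b, c` are joined in the support `DY`, `C(a)` does not cut.
-/

namespace Summit.CriticalPhenomena.PercolationContinuityZ3.Theorems

namespace OneSumApex

open SimpleGraph Finset Literature.Probability.Percolation Literature.Probability.Percolation.Gladkov
open Literature.Probability.LatticeModels RefinedRowR3 ThreePointLB APL
open scoped Classical

variable {V : Type*}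

/-- Wiring a single vertex does nothing: `k^{{u,u}} = k`. [folklore] -/
theorem clusterCount_pair_self (u : V) (ω : BondConfig V) : clusterCount ω ({u, u} : Set V) = clusterCount ω ∅ := by
  have h : wired ({u, u} : Set V) = ⊥ := by
    ext x y
    simp only [wired_adj, Set.mem_insert_iff, Set.mem_singleton_iff, or_self, bot_adj, iff_false, not_and]
    intro hne hx hy
    exact hne (hx.trans hy.symm)
  unfold clusterCount
  rw [h, wired_empty]

variable [Fintype V] {DX DY : Finset (Sym2 V)} {a b c u : V}

section Join

variable (hau : a ≠ u) (hbu : b ≠ u) (hcu : c ≠ u) (hab : a ≠ b) (hac : a ≠ c) (hbc : b ≠ c)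
  (hsepD : ∀ x : V, (∃ e ∈ DX, x ∈ e) → (∃ e ∈ DY, x ∈ e) → (x = u ∨ x = u))
  (haY : ∀ e ∈ DY, a ∉ e) (hbX : ∀ e ∈ DX, b ∉ e) (hcX : ∀ e ∈ DX, c ∉ e)

include hsepD hau haY in
/-- **Join rule for a terminal `t` private to `DY`**: `t ∈ C(a)` iff `u ∈ C_X(a)` and `t ∈ C_Y(u)`. [this work] -/
theorem glued_t_iff {t : V} (hat : a ≠ t) (htX : ∀ e ∈ DX, t ∉ e) {ω : BondConfig V} (hω : ω ⊆ ↑DX ∪ ↑DY) :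
    t ∈ cl ω.toFinset a ↔
      ((ω ∩ ↑DX) ∈ {η : BondConfig V | u ∈ cl η.toFinset a} ∧ (ω \ ↑DX) ∈ {η : BondConfig V | t ∈ cl η.toFinset u}) := by
  simp only [Set.mem_setOf_eq]
  suffices key : ∀ ζX ζY : Finset (Sym2 V), (∀ e, e ∈ ζX ↔ e ∈ ω ∩ (↑DX : Set (Sym2 V))) →
      (∀ e, e ∈ ζY ↔ e ∈ ω \ (↑DX : Set (Sym2 V))) → (t ∈ cl ω.toFinset a ↔ (u ∈ cl ζX a ∧ t ∈ cl ζY u)) by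
    exact key _ _ (fun e => by simp only [Set.mem_toFinset]) (fun e => by simp only [Set.mem_toFinset])
  intro ζX ζY hX hY
  obtain ⟨hωζ, hXD, hYD, hsep⟩ := ApexTwoSum.blocks_of_eq hsepD hω hX hY
  have hsep' : ∀ x : V, (∃ e ∈ ζY, x ∈ e) → (∃ e ∈ ζX, x ∈ e) → (x = a ∨ x = u) :=
    fun x h1 h2 => Or.inr ((hsep x h2 h1).elim id id)
  have haY' : ∀ e ∈ ζY, a ∉ e := fun e he => haY e (hYD he)
  have htX' : ∀ e ∈ ζX, t ∈ e → t = u := fun e he hte => absurd hte (htX e (hXD he))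
  rw [hωζ, Finset.union_comm]
  rw [APL.series_ou_iff ζY ζX a u t hsep' htX' hat.symm]
  have n1 : t ∉ cl ζY a := fun h => hat (ApexTwoSum.eq_of_mem_cl_of_forall_not_mem haY' h).symm
  have n2 : u ∉ cl ζY a := fun h => hau (ApexTwoSum.eq_of_mem_cl_of_forall_not_mem haY' h).symm
  constructor
  · rintro (h1 | ⟨h2, h3 | h3⟩)
    · exact absurd h1 n1
    · exact absurd h3 n2
    · exact ⟨h3, mem_cl_comm.1 h2⟩
  · rintro ⟨h1, h2⟩
    exact Or.inr ⟨mem_cl_comm.1 h2, Or.inr h1⟩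

include hsepD hbX hcX hbu in
/-- **Join rule `b ~ c` inside the far piece**: for `b, c` private to `DY`, `c ∈ C(b)` iff `c ∈ C_Y(b)`. [this work] -/
theorem glued_cb_iff {ω : BondConfig V} (hω : ω ⊆ ↑DX ∪ ↑DY) :
    c ∈ cl ω.toFinset b ↔ (ω \ ↑DX) ∈ {η : BondConfig V | c ∈ cl η.toFinset b} := by
  simp only [Set.mem_setOf_eq]
  suffices key : ∀ ζX ζY : Finset (Sym2 V), (∀ e, e ∈ ζX ↔ e ∈ ω ∩ (↑DX : Set (Sym2 V))) →
      (∀ e, e ∈ ζY ↔ e ∈ ω \ (↑DX : Set (Sym2 V))) → (c ∈ cl ω.toFinset b ↔ c ∈ cl ζY b) by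
    exact key (ω ∩ (↑DX : Set (Sym2 V))).toFinset _ (fun e => by simp only [Set.mem_toFinset])
      (fun e => by simp only [Set.mem_toFinset])
  intro ζX ζY hX hY
  obtain ⟨hωζ, hXD, -, hsep⟩ := ApexTwoSum.blocks_of_eq hsepD hω hX hY
  by_cases hcb : c = b
  · subst hcb; simp [mem_cl_self, hωζ]
  have hsep' : ∀ x : V, (∃ e ∈ ζY, x ∈ e) → (∃ e ∈ ζX, x ∈ e) → (x = b ∨ x = u) :=
    fun x h1 h2 => Or.inr ((hsep x h2 h1).elim id id)
  have hcX' : ∀ e ∈ ζX, c ∈ e → c = u := fun e he hce => absurd hce (hcX e (hXD he))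
  have hbX' : ∀ e ∈ ζX, b ∉ e := fun e he => hbX e (hXD he)
  rw [hωζ, Finset.union_comm, APL.series_ou_iff ζY ζX b u c hsep' hcX' hcb]
  constructor
  · rintro (h1 | ⟨h2, h3 | h3⟩)
    · exact h1
    · exact mem_cl_trans h3 (mem_cl_comm.1 h2)
    · exact absurd (ApexTwoSum.eq_of_mem_cl_of_forall_not_mem hbX' h3) (Ne.symm hbu)
  · exact fun h => Or.inl h

end Join

/-! ### The separation rule -/

section Separation

variable (hau : a ≠ u) (hbu : b ≠ u) (hcu : c ≠ u) (hab : a ≠ b) (hac : a ≠ c) (hbc : b ≠ c)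
  (hsepD : ∀ x : V, (∃ e ∈ DX, x ∈ e) → (∃ e ∈ DY, x ∈ e) → (x = u ∨ x = u))
  (haY : ∀ e ∈ DY, a ∉ e) (hbX : ∀ e ∈ DX, b ∉ e) (hcX : ∀ e ∈ DX, c ∉ e)

include hsepD hbc hcX hcu in
/-- **Separation rule, cut vertex inside the apex cluster** (Finset form): if `u ∈ C_X(a)` and `b, c ∉ C(a)` then `C(a)` cuts `b|c` in
`DX ∪ DY` iff `C_Y(u)` cuts `b|c` in `DY`. [this work] -/
theorem sep_iff_of_mem_fin {ζX ζY : Finset (Sym2 V)} (hζX : ζX ⊆ DX)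
    (hsep : ∀ x : V, (∃ e ∈ ζX, x ∈ e) → (∃ e ∈ ζY, x ∈ e) → (x = u ∨ x = u))
    (hu : u ∈ cl ζX a) (hb : b ∉ cl (ζX ∪ ζY) a) (hc : c ∉ cl (ζX ∪ ζY) a) :
    Sep (DX ∪ DY) (cl (ζX ∪ ζY) a) b c ↔ Sep DY (cl ζY u) b c := by
  -- the glued cluster of `a` is the glued cluster of `u`, which splits off `b` and `c`
  have hu' : u ∈ cl (ζX ∪ ζY) a := cl_mono Finset.subset_union_left a hu
  have hK : cl (ζX ∪ ζY) a = cl (ζX ∪ ζY) u := by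
    ext x; exact ⟨fun h => mem_cl_trans (mem_cl_comm.1 hu') h, fun h => mem_cl_trans hu' h⟩
  have hbu' : b ∉ cl (ζX ∪ ζY) u := fun h => hb (hK ▸ h)
  have hcu' : c ∉ cl (ζX ∪ ζY) u := fun h => hc (hK ▸ h)
  have hbXc : b ∉ cl ζX u := fun h => hbu' (cl_mono Finset.subset_union_left u h)
  have hbYc : b ∉ cl ζY u := fun h => hbu' (cl_mono Finset.subset_union_right u h)
  have hsep3 : ∀ x : V, (∃ e ∈ ζX, x ∈ e) → (∃ e ∈ ζY, x ∈ e) → (x = u ∨ x = b ∨ x = b) :=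
    fun x h1 h2 => Or.inl ((hsep x h1 h2).elim id id)
  have hsepD3 : ∀ x : V, (∃ e ∈ DX, x ∈ e) → (∃ e ∈ DY, x ∈ e) → (x = u ∨ x = b ∨ x = b) :=
    fun x h1 h2 => Or.inl ((hsepD x h1 h2).elim id id)
  have hcl : cl (ζX ∪ ζY) u = cl ζX u ∪ cl ζY u := ThreeSum.cl_union_eq hsep3 hbXc hbXc hbYc hbYc
  unfold RefinedRowR3.Sep
  rw [hK, hcl, Finset.union_sdiff_distrib, ThreeSum.sdiff_touch_union_right hsepD3 hζX hbXc hbXc]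
  set EX := DX \ touch (cl ζX u ∪ cl ζY u) with hEX
  set EY := DY \ touch (cl ζY u) with hEY
  have huY : ∀ e ∈ EY, u ∉ e := fun e he hue => by
    rw [hEY, Finset.mem_sdiff] at he
    exact he.2 (mem_touch.2 ⟨u, mem_cl_self _ _, hue⟩)
  have hsepE : ∀ x : V, (∃ e ∈ EY, x ∈ e) → (∃ e ∈ EX, x ∈ e) → (x = b ∨ x = u) := by
    rintro x ⟨e, he, hxe⟩ ⟨e', he', hxe'⟩
    have h1 : e ∈ DY := by rw [hEY, Finset.mem_sdiff] at he; exact he.1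
    have h2 : e' ∈ DX := by rw [hEX, Finset.mem_sdiff] at he'; exact he'.1
    exact Or.inr ((hsepD x ⟨e', h2, hxe'⟩ ⟨e, h1, hxe⟩).elim id id)
  have hcEX : ∀ e ∈ EX, c ∈ e → c = u := fun e he hce => by
    rw [hEX, Finset.mem_sdiff] at he; exact absurd hce (hcX e he.1)
  rw [Finset.union_comm, APL.series_ou_iff EY EX b u c hsepE hcEX hbc.symm]
  constructor
  · intro hn h1
    exact hn (Or.inl h1)
  · rintro hn (h1 | ⟨h2, -⟩)
    · exact hn h1
    · exact hcu (ApexTwoSum.eq_of_mem_cl_of_forall_not_mem huY (mem_cl_comm.1 h2))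

include hsepD hau haY in
/-- **No separation when the cut vertex is outside the apex cluster** (Finset form): if `u ∉ C_X(a)` and `b, c` are joined in the
support `DY`, then `C(a) = C_X(a)` does not meet every `b–c` path. [this work] -/
theorem not_sep_of_not_mem_fin {ζX ζY : Finset (Sym2 V)} (hζX : ζX ⊆ DX) (hζY : ζY ⊆ DY)
    (hsep : ∀ x : V, (∃ e ∈ ζX, x ∈ e) → (∃ e ∈ ζY, x ∈ e) → (x = u ∨ x = u))
    (hu : u ∉ cl ζX a) (hY : c ∈ cl DY b) : ¬ Sep (DX ∪ DY) (cl (ζX ∪ ζY) a) b c := by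
  have haY' : ∀ e ∈ ζY, a ∉ e := fun e he => haY e (hζY he)
  have huY : u ∉ cl ζY a := fun h => hau (ApexTwoSum.eq_of_mem_cl_of_forall_not_mem haY' h).symm
  have hsep3 : ∀ x : V, (∃ e ∈ ζX, x ∈ e) → (∃ e ∈ ζY, x ∈ e) → (x = a ∨ x = u ∨ x = u) :=
    fun x h1 h2 => Or.inr (hsep x h1 h2)
  have hsepD3 : ∀ x : V, (∃ e ∈ DX, x ∈ e) → (∃ e ∈ DY, x ∈ e) → (x = a ∨ x = u ∨ x = u) :=
    fun x h1 h2 => Or.inr (hsepD x h1 h2)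
  have hcl : cl (ζX ∪ ζY) a = cl ζX a ∪ cl ζY a := ThreeSum.cl_union_eq hsep3 hu hu huY huY
  intro hS
  unfold RefinedRowR3.Sep at hS
  rw [hcl, Finset.union_sdiff_distrib, ThreeSum.sdiff_touch_union_right hsepD3 hζX hu hu] at hS
  have hDY : DY \ touch (cl ζY a) = DY := by
    refine Finset.sdiff_eq_self_of_disjoint (Finset.disjoint_left.2 fun e he hte => ?_)
    obtain ⟨x, hx, hxe⟩ := mem_touch.1 hte
    have hxa : x = a := ApexTwoSum.eq_of_mem_cl_of_forall_not_mem haY' hx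
    exact haY e he (hxa ▸ hxe)
  rw [hDY] at hS
  exact hS (cl_mono Finset.subset_union_right b hY)

include hsepD hbc hcX hcu in
/-- **Separation rule, cut vertex inside the apex cluster** (event form). [this work] -/
theorem sep_iff_of_mem {ω : BondConfig V} (hω : ω ⊆ ↑DX ∪ ↑DY)
    (hu : (ω ∩ ↑DX) ∈ {η : BondConfig V | u ∈ cl η.toFinset a}) (hb : b ∉ cl ω.toFinset a) (hc : c ∉ cl ω.toFinset a) :
    Sep (DX ∪ DY) (cl ω.toFinset a) b c ↔ (ω \ ↑DX) ∈ {η : BondConfig V | Sep DY (cl η.toFinset u) b c} := by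
  simp only [Set.mem_setOf_eq] at hu ⊢
  suffices key : ∀ ζX ζY : Finset (Sym2 V), (∀ e, e ∈ ζX ↔ e ∈ ω ∩ (↑DX : Set (Sym2 V))) →
      (∀ e, e ∈ ζY ↔ e ∈ ω \ (↑DX : Set (Sym2 V))) → u ∈ cl ζX a →
      (Sep (DX ∪ DY) (cl ω.toFinset a) b c ↔ Sep DY (cl ζY u) b c) by
    exact key _ _ (fun e => by simp only [Set.mem_toFinset]) (fun e => by simp only [Set.mem_toFinset]) hu
  intro ζX ζY hX hY hu'
  obtain ⟨hωζ, hXD, -, hsep⟩ := ApexTwoSum.blocks_of_eq hsepD hω hX hY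
  rw [hωζ] at hb hc ⊢
  exact sep_iff_of_mem_fin hcu hbc hsepD hcX hXD hsep hu' hb hc

include hsepD hau haY in
/-- **No separation when the cut vertex is outside the apex cluster** (event form). [this work] -/
theorem not_sep_of_not_mem {ω : BondConfig V} (hω : ω ⊆ ↑DX ∪ ↑DY)
    (hu : (ω ∩ ↑DX) ∉ {η : BondConfig V | u ∈ cl η.toFinset a}) (hY : c ∈ cl DY b) :
    ¬ Sep (DX ∪ DY) (cl ω.toFinset a) b c := by
  simp only [Set.mem_setOf_eq] at hu
  suffices key : ∀ ζX ζY : Finset (Sym2 V), (∀ e, e ∈ ζX ↔ e ∈ ω ∩ (↑DX : Set (Sym2 V))) →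
      (∀ e, e ∈ ζY ↔ e ∈ ω \ (↑DX : Set (Sym2 V))) → u ∉ cl ζX a → ¬ Sep (DX ∪ DY) (cl ω.toFinset a) b c by
    exact key _ (ω \ (↑DX : Set (Sym2 V))).toFinset (fun e => by simp only [Set.mem_toFinset])
      (fun e => by simp only [Set.mem_toFinset]) hu
  intro ζX ζY hX hY' hu'
  obtain ⟨hωζ, hXD, hYD, hsep⟩ := ApexTwoSum.blocks_of_eq hsepD hω hX hY'
  rw [hωζ]
  exact not_sep_of_not_mem_fin hau hsepD haY hXD hYD hsep hu' hY

end Separation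

end OneSumApex

end Summit.CriticalPhenomena.PercolationContinuityZ3.Theorems
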